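import Summits.AtomisticToContinuum.Crystallization.Theses.SoftAnnulusKernel
import Literature.Geometry.DiscreteGeometry.FlyspeckL12

/-!
# Soft `L12` (supports crux `SoftLocalTwelveFourCommon`, item stmt-AtomisticToContinuum-18404)

The soft separation gap of a softly twelve-coordinated point, from the WEIGHTED Flyspeck local annulus
inequality `flyspeck_L12` (Hales 2012, Lemma 1; *Dense Sphere Packings* Lemma 6.95 — HOL-Light verified, a
named fact of this tree): in a `(1−η)`-separated `Z ⊂ ℝ³` (`0 ≤ η ≤ 10⁻³`) a point `u` with exactly twelve
other points within `1 + η` has every other point within `1 + η` or at distance `≥ 63/50 − 26η`.  Rescale by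
`2/(1−η)` about `u`; the twelve neighbours carry weight `≥ 1 − δ/0.26` each (`δ = 2η/(1−η)`), so a thirteenth
at half-distance `h` has `L(h) ≤ 12δ/0.26`, i.e. `h ≥ 1.26 − 12δ`; in original units `≥ 1.26 − 25.26η`.
This is stub 1 of the crux's birth skeleton, discharged modulo the named fact.
-/

noncomputable section

namespace Summit.AtomisticToContinuum.Crystallization.Theorems

open Literature.Geometry.DiscreteGeometry

/-- **Soft `L12`** from `flyspeck_L12` (Hales 2012, Lemma 1, weighted form). -/
theorem softTwelveGap_of_flyspeckL12 (hL12 : flyspeck_L12) :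
    ∀ η : ℝ, 0 ≤ η → η ≤ 1 / 1000 → ∀ Z : Set (EuclideanSpace ℝ (Fin 3)),
      (∀ x ∈ Z, ∀ y ∈ Z, x ≠ y → 1 - η ≤ dist x y) →
      ∀ u ∈ Z, {w ∈ Z | w ≠ u ∧ dist w u ≤ 1 + η}.ncard = 12 →
        ∀ v ∈ Z, v ≠ u → dist v u ≤ 1 + η ∨ (63 / 50 - 26 * η : ℝ) ≤ dist v u := by
  intro η hη0 hη1 Z hsep u hu h12 v hv hvu
  by_contra hcon
  push Not at hcon
  obtain ⟨hlt1, hlt2⟩ := hcon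
  have h0 : hales_h0 = 63 / 50 := by rw [hales_h0_eq]; norm_num
  have h1η : 0 < 1 - η := by linarith
  -- the soft shell of `u`
  set N : Set (EuclideanSpace ℝ (Fin 3)) := {w ∈ Z | w ≠ u ∧ dist w u ≤ 1 + η} with hN
  have hNfin : N.Finite := Set.finite_of_ncard_ne_zero (by rw [h12]; norm_num)
  -- rescaling about `u`
  set s : ℝ := 2 / (1 - η) with hs
  have hspos : 0 < s := by positivity
  have hs1 : s * (1 - η) = 2 := by rw [hs]; field_simp
  set f : (EuclideanSpace ℝ (Fin 3)) → (EuclideanSpace ℝ (Fin 3)) := fun w => s • (w - u) with hf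
  have hfnorm : ∀ w, ‖f w‖ = s * dist w u := by
    intro w
    show ‖s • (w - u)‖ = s * dist w u
    rw [norm_smul, Real.norm_of_nonneg hspos.le, dist_eq_norm]
  have hfdist : ∀ a b, dist (f a) (f b) = s * dist a b := by
    intro a b
    show dist (s • (a - u)) (s • (b - u)) = s * dist a b
    rw [dist_smul₀, Real.norm_of_nonneg hspos.le, dist_sub_right]
  have hfinj : Function.Injective f := by
    intro a b hab
    have h := hfdist a b
    rw [hab, dist_self] at h
    have : dist a b = 0 := by
      rcases mul_eq_zero.1 h.symm with h' | h'
      · exact absurd h' hspos.ne'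
      · exact h'
    exact dist_eq_zero.1 this
  set F : Finset (EuclideanSpace ℝ (Fin 3)) := hNfin.toFinset.image f with hF
  have hmemF : ∀ p, p ∈ F ↔ ∃ w ∈ N, f w = p := by
    intro p
    simp only [hF, Finset.mem_image, Set.Finite.mem_toFinset]
  have hFcard : F.card = 12 := by
    rw [hF, Finset.card_image_of_injective _ hfinj, ← Set.ncard_eq_toFinset_card N hNfin, h12]
  have hvF : f v ∉ F := by
    intro h
    obtain ⟨w, hw, hwv⟩ := (hmemF _).1 h
    have hwv' : w = v := hfinj hwv
    rw [hwv'] at hw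
    exact absurd hw.2.2 (not_le.2 hlt1)
  -- membership in the thirteen-point set
  have hmem13 : ∀ p ∈ insert (f v) F, ∃ a ∈ Z, (a = v ∨ a ∈ N) ∧ f a = p := by
    intro p hp
    rcases Finset.mem_insert.1 hp with rfl | hp
    · exact ⟨v, hv, Or.inl rfl, rfl⟩
    · obtain ⟨w, hw, rfl⟩ := (hmemF p).1 hp
      exact ⟨w, hw.1, Or.inr hw, rfl⟩
  -- distances from `u`
  have hdistu : ∀ a, (a = v ∨ a ∈ N) → 1 - η ≤ dist a u ∧ dist a u < 63 / 50 - 26 * η := by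
    intro a ha
    rcases ha with rfl | ha
    · exact ⟨by linarith, hlt2⟩
    · exact ⟨hsep a ha.1 u hu ha.2.1, by linarith [ha.2.2]⟩
  -- apply `L12`
  have hsum := hL12 (insert (f v) F) ?_ ?_
  rotate_left
  · -- packing
    intro p hp q hq hpq
    obtain ⟨a, ha, -, rfl⟩ := hmem13 p hp
    obtain ⟨b, hb, -, rfl⟩ := hmem13 q hq
    have hab : a ≠ b := fun h => hpq (by rw [h])
    rw [hfdist]
    have := mul_le_mul_of_nonneg_left (hsep a ha b hb hab) hspos.le
    linarith [hs1]
  · -- annulus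
    intro p hp
    obtain ⟨a, ha, ha', rfl⟩ := hmem13 p hp
    obtain ⟨hlo, hhi⟩ := hdistu a ha'
    rw [hfnorm, h0]
    constructor
    · have := mul_le_mul_of_nonneg_left hlo hspos.le
      linarith [hs1]
    · rw [hs, div_mul_eq_mul_div, div_le_iff₀ h1η]
      nlinarith
  -- evaluate the sum
  rw [Finset.sum_insert hvF] at hsum
  -- each of the twelve weights is at least `m`
  set b : ℝ := (1 + η) / (1 - η) with hb
  have hb1 : b * (1 - η) = 1 + η := by rw [hb]; field_simp
  set m : ℝ := (63 / 50 - b) / (63 / 50 - 1) with hm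
  have hFw : ∀ p ∈ F, m ≤ halesL (‖p‖ / 2) := by
    intro p hp
    obtain ⟨w, hw, rfl⟩ := (hmemF p).1 hp
    have hh : ‖f w‖ / 2 = dist w u / (1 - η) := by
      rw [hfnorm, hs]
      field_simp
    have hle : dist w u / (1 - η) ≤ b := by
      rw [hb]
      exact div_le_div_of_nonneg_right hw.2.2 h1η.le
    rw [halesL_apply, h0, hh, hm]
    apply div_le_div_of_nonneg_right _ (by norm_num)
    linarith
  have hFsum : (12 : ℝ) * m ≤ ∑ p ∈ F, halesL (‖p‖ / 2) := by
    have := Finset.card_nsmul_le_sum F (fun p => halesL (‖p‖ / 2)) m hFw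
    rw [hFcard, nsmul_eq_mul] at this
    exact_mod_cast this
  -- the thirteenth weight
  set a : ℝ := dist v u / (1 - η) with ha
  have ha1 : a * (1 - η) = dist v u := by rw [ha]; field_simp
  have hav : halesL (‖f v‖ / 2) = (63 / 50 - a) / (63 / 50 - 1) := by
    have hh : ‖f v‖ / 2 = dist v u / (1 - η) := by
      rw [hfnorm, hs]
      field_simp
    rw [halesL_apply, h0, hh]
  rw [hav] at hsum
  -- linear bookkeeping: `(63/50 - a) + 12 (63/50 - b) ≤ 12 · 13/50`
  have key : (63 / 50 - a) + 12 * (63 / 50 - b) ≤ 12 * (13 / 50) := by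
    have e1 : (63 / 50 - a) / (63 / 50 - 1) = (63 / 50 - a) / (13 / 50) := by norm_num
    have e2 : m = (63 / 50 - b) / (13 / 50) := by rw [hm]; norm_num
    rw [e1] at hsum
    rw [e2] at hFsum
    have h3 : (63 / 50 - a) / (13 / 50 : ℝ) + 12 * ((63 / 50 - b) / (13 / 50)) ≤ 12 := by linarith
    have h4 : ((63 / 50 - a) + 12 * (63 / 50 - b)) / (13 / 50 : ℝ) ≤ 12 := by
      have : ((63 / 50 - a) + 12 * (63 / 50 - b)) / (13 / 50 : ℝ) =
          (63 / 50 - a) / (13 / 50 : ℝ) + 12 * ((63 / 50 - b) / (13 / 50)) := by ring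
      rw [this]; exact h3
    rwa [div_le_iff₀ (by norm_num : (0 : ℝ) < 13 / 50)] at h4
  have key' : 663 / 50 - 12 * b ≤ a := by linarith
  -- multiply by `1 - η` and conclude
  have hmul := mul_le_mul_of_nonneg_right key' h1η.le
  have : 63 / 50 - 1263 / 50 * η ≤ dist v u := by nlinarith [hmul, ha1, hb1]
  linarith



end Summit.AtomisticToContinuum.Crystallization.Theorems

end
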